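import Summits.RiemannHypothesis.RiemannHypothesis.Theorems.WeilFormatCColumnEven
import Summits.RiemannHypothesis.RiemannHypothesis.Theorems.WeilFormatCColumnOdd
import Summits.RiemannHypothesis.RiemannHypothesis.Theorems.WeilFormatCInvSqDiffExpansion
import HarnessLib

/-!
# Format C, L-C3b at every order: the Cauchy structure of the far columns and the order-`J` remainder

Route context: Fourier–Galerkin / Schur-complement certificates of Weil positivity on a window ("format C";
cell memo `run/shared/lean/pub/rh-explicit/rh-explicit-weil-10/FORMATC-DESIGN.md` §9.9; supporting
stmt-RiemannHypothesis-0098; seat rh-explicit-weil-10).  The coupling columns of weil-2's SectorSplit kernels of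
`G = Yoshida1992.gramCoeff a` have an EXACT two-term structure with ONE mode function
`F_n := ½·Im ψ(¼ + iω_n/2) + Σ_k (Λ_k/√k) sin(ω_n log k) − T_n` (`T_n = archExpSumSin a n`):

* `evenKernel_col_eq` — `M⁺(i,m) = (−1)^{i+m}[(4s²/a)c_ic_m + (mF_m − iF_i)/(π(m² − i²))]` for `0 ≤ i < m`
  (`c = 1/(1+4ω²)`; the zero row included, `F_0 = 0`);
* `oddKernel_col_eq` — `M⁻(i,m) = (−1)^{i+m}[−(16s²/a)d_id_m + (iF_m − mF_i)/(π(m² − i²))]` for `1 ≤ i < m` (modes; kernel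
  indices `i−1`, `m−1`; `d = ω/(1+4ω²)`);
* `abs_modeF_le` — `|F_n| ≤ C_F := π/4 + ΛΣ + a(1+E)/π` for `n ≥ 1` (`E = weilArchDensity (2a)`, `ΛΣ = Σ_k Λ_k/√k`);
* `abs_evenKernel_col_sub_sum_le`, `abs_oddKernel_col_sub_sum_le` — for every `J`, on `2i ≤ m`, expanding `1/(m² − i²)` by
  `inv_sq_sub_sq_eq`: `|M⁺(i,m) − (−1)^{i+m}[(4s²/a)c_ic_m + Σ_{j<J}(F_m i^{2j}/(πm^{2j+1}) − F_i i^{2j+1}/(πm^{2j+2}))]|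
  ≤ 2C_F·i^{2J}/(π m^{2J+1})`, and the odd analogue with `Σ_{j<J}(F_m i^{2j+1}/(πm^{2j+2}) − F_i i^{2j}/(πm^{2j+1}))`.

So the structured tail of L-C3b has rank `2J+1` at order `J` with a remainder decaying like `(i/m)^{2J}/m` — the input of
`WeilFormatCTailJ.lean`.  Elementary (the closed forms of `WeilFormatCColumnEvenEntries` / `WeilFormatCColumnOdd` +
algebra); standard axioms; no definitions; no RH claim.
-/

set_option autoImplicit false
-- `Summit.RiemannHypothesis.RiemannHypothesis.…` is the layout-mandated namespace (summit = problem name).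
set_option linter.dupNamespace false

noncomputable section

open Complex Finset
open scoped Real BigOperators ArithmeticFunction.vonMangoldt

namespace Summit.RiemannHypothesis.RiemannHypothesis.Theorems.WeilFormatC

open Literature.NumberTheory.LFunctions Literature.NumberTheory.LFunctions.Yoshida1992
open Literature.Analysis.SpecialFunctions

variable {a : ℝ}

/-! ## The exact column structure -/

section Structure

/-- Pulling the block/column factors out of the prime sum:
`Σ_k w_k (x·s_k − y·t_k)/D = (x·Σ_k w_k s_k − y·Σ_k w_k t_k)/D`. -/
theorem sum_mul_sub_div_eq (S : Finset ℕ) (w s t : ℕ → ℝ) (x y D : ℝ) :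
    ∑ k ∈ S, w k * ((x * s k - y * t k) / D)
      = (x * ∑ k ∈ S, w k * s k - y * ∑ k ∈ S, w k * t k) / D := by
  rw [Finset.mul_sum, Finset.mul_sum, ← Finset.sum_sub_distrib, Finset.sum_div]
  refine Finset.sum_congr rfl fun k _ ↦ by ring

/-- **Even column structure.**  For `1 ≤ m`, `i < m` (`i = 0` allowed):
`M⁺(i,m) = (−1)^{i+m}[(4/a)s² c_i c_m + (m F_m − i F_i)/(π(m² − i²))]`. -/
theorem evenKernel_col_eq (a : ℝ) {i m : ℕ} (hm : 1 ≤ m) (him : i < m) :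
    (if i = 0 then gramCoeff a 0 m else if m = 0 then gramCoeff a i 0
        else (gramCoeff a i m + gramCoeff a i (-(m : ℤ))) / 2)
      = (-1 : ℝ) ^ ((i : ℤ) + m) *
        (4 / a * (Real.exp (a / 2) - Real.exp (-(a / 2))) ^ 2 * (1 / (1 + 4 * freq a i ^ 2)) * (1 / (1 + 4 * freq a m ^ 2))
          + ((m : ℝ) * ((Complex.digamma (1 / 4 + ((freq a m : ℝ) : ℂ) / 2 * I)).im / 2
                + (∑ k ∈ weilPrimeIndex a, (Λ k : ℝ) / Real.sqrt k * Real.sin (freq a m * Real.log k)) - archExpSumSin a m)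
              - i * ((Complex.digamma (1 / 4 + ((freq a i : ℝ) : ℂ) / 2 * I)).im / 2
                + (∑ k ∈ weilPrimeIndex a, (Λ k : ℝ) / Real.sqrt k * Real.sin (freq a i * Real.log k)) - archExpSumSin a i))
            / (π * ((m : ℝ) ^ 2 - i ^ 2))) := by
  have hsplit : (if i = 0 then gramCoeff a 0 m else if m = 0 then gramCoeff a i 0
        else (gramCoeff a i m + gramCoeff a i (-(m : ℤ))) / 2)
      = (if i = 0 then polarCoeff a 0 m else if m = 0 then polarCoeff a i 0
          else (polarCoeff a i m + polarCoeff a i (-(m : ℤ))) / 2)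
        + (if i = 0 then primeCoeff a 0 m else if m = 0 then primeCoeff a i 0
          else (primeCoeff a i m + primeCoeff a i (-(m : ℤ))) / 2)
        + (if i = 0 then archCoeff a 0 m else if m = 0 then archCoeff a i 0
          else (archCoeff a i m + archCoeff a i (-(m : ℤ))) / 2) := by
    by_cases hi : i = 0
    · subst hi; simp only [if_true]; unfold gramCoeff; ring
    · have hm' : m ≠ 0 := by omega
      simp only [if_neg hi, if_neg hm']
      unfold gramCoeff; ring
  rw [hsplit, evenPolar_col_eq a hm (ne_of_lt him), evenPrime_col_eq a hm him, evenArch_col_eq a hm him,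
    sum_mul_sub_div_eq]
  have hd1' : (m : ℝ) - i ≠ 0 := sub_ne_zero.mpr (by exact_mod_cast (ne_of_gt him))
  have hD : (m : ℝ) ^ 2 - i ^ 2 ≠ 0 := by rw [sq_sub_sq]; exact mul_ne_zero (by positivity) hd1'
  field_simp
  ring

/-- **Odd column structure.**  For `1 ≤ i < m` (modes):
`M⁻(i,m) = (−1)^{i+m}[−(16/a)s² d_i d_m + (i F_m − m F_i)/(π(m² − i²))]`. -/
theorem oddKernel_col_eq (a : ℝ) {i m : ℕ} (hi : 1 ≤ i) (him : i < m) :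
    (gramCoeff a i m - gramCoeff a i (-(m : ℤ))) / 2
      = (-1 : ℝ) ^ ((i : ℤ) + m) *
        (-(16 / a * (Real.exp (a / 2) - Real.exp (-(a / 2))) ^ 2) * (freq a i / (1 + 4 * freq a i ^ 2))
            * (freq a m / (1 + 4 * freq a m ^ 2))
          + ((i : ℝ) * ((Complex.digamma (1 / 4 + ((freq a m : ℝ) : ℂ) / 2 * I)).im / 2
                + (∑ k ∈ weilPrimeIndex a, (Λ k : ℝ) / Real.sqrt k * Real.sin (freq a m * Real.log k)) - archExpSumSin a m)
              - m * ((Complex.digamma (1 / 4 + ((freq a i : ℝ) : ℂ) / 2 * I)).im / 2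
                + (∑ k ∈ weilPrimeIndex a, (Λ k : ℝ) / Real.sqrt k * Real.sin (freq a i * Real.log k)) - archExpSumSin a i))
            / (π * ((m : ℝ) ^ 2 - i ^ 2))) := by
  have hm : 1 ≤ m := le_trans hi (le_of_lt him)
  have hsplit : (gramCoeff a i m - gramCoeff a i (-(m : ℤ))) / 2
      = (polarCoeff a i m - polarCoeff a i (-(m : ℤ))) / 2
        + (primeCoeff a i m - primeCoeff a i (-(m : ℤ))) / 2
        + (archCoeff a i m - archCoeff a i (-(m : ℤ))) / 2 := by
    unfold gramCoeff; ring
  rw [hsplit, oddPolar_col_eq a i m, oddPrime_col_eq a hi him, oddArch_offDiag_eq a hi hm (ne_of_lt him),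
    sum_mul_sub_div_eq]
  have hd1' : (m : ℝ) - i ≠ 0 := sub_ne_zero.mpr (by exact_mod_cast (ne_of_gt him))
  have hD : (m : ℝ) ^ 2 - i ^ 2 ≠ 0 := by rw [sq_sub_sq]; exact mul_ne_zero (by positivity) hd1'
  have hD' : (i : ℝ) ^ 2 - m ^ 2 ≠ 0 := by
    rw [show (i : ℝ) ^ 2 - m ^ 2 = -((m : ℝ) ^ 2 - i ^ 2) by ring]; exact neg_ne_zero.mpr hD
  field_simp
  ring

end Structure

/-! ## The size of the mode function `F_n` -/

section ModeF

/-- **`|F_n| ≤ C_F`** for every `n : ℕ`, `a > 0`: `|½Y_n + P_n − T_n| ≤ π/4 + ΛΣ + a(1+E)/π`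
(`n ≥ 1`: `|Y_n − π/2| ≤ 2a/(πn)`, `|P_n| ≤ ΛΣ`, `0 ≤ T_n ≤ Ea/(πn)`; `n = 0`: `F_0 = 0`). -/
theorem abs_modeF_le (ha : 0 < a) (n : ℕ) :
    |(Complex.digamma (1 / 4 + ((freq a n : ℝ) : ℂ) / 2 * I)).im / 2
        + (∑ k ∈ weilPrimeIndex a, (Λ k : ℝ) / Real.sqrt k * Real.sin (freq a n * Real.log k)) - archExpSumSin a n|
      ≤ π / 4 + (∑ k ∈ weilPrimeIndex a, (Λ k : ℝ) / Real.sqrt k) + a * (1 + weilArchDensity (2 * a)) / π := by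
  have hE0 : 0 < weilArchDensity (2 * a) := weilArchDensity_pos (by positivity)
  have hL : 0 ≤ ∑ k ∈ weilPrimeIndex a, (Λ k : ℝ) / Real.sqrt k :=
    Finset.sum_nonneg fun k _ ↦ div_nonneg ArithmeticFunction.vonMangoldt_nonneg (Real.sqrt_nonneg _)
  rcases Nat.eq_zero_or_pos n with h0 | hn
  · subst h0
    simp only [CharP.cast_eq_zero]
    rw [im_digamma_quarter_zero, archExpSumSin_zero, freq_zero]
    simp only [zero_mul, Real.sin_zero, mul_zero, Finset.sum_const_zero, zero_div, zero_add, sub_zero, abs_zero]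
    positivity
  have hn1 : 1 ≤ n := hn
  have hn0 : (0 : ℝ) < n := by exact_mod_cast hn1
  have hY := abs_im_digamma_freq_sub_le ha hn1
  have hT0 := archExpSumSin_nonneg ha hn1
  have hT := archExpSumSin_le ha hn1
  have hP : |∑ k ∈ weilPrimeIndex a, (Λ k : ℝ) / Real.sqrt k * Real.sin (freq a n * Real.log k)|
      ≤ ∑ k ∈ weilPrimeIndex a, (Λ k : ℝ) / Real.sqrt k := by
    refine (Finset.abs_sum_le_sum_abs _ _).trans (Finset.sum_le_sum fun k _ ↦ ?_)
    have hw : 0 ≤ (Λ k : ℝ) / Real.sqrt k := div_nonneg ArithmeticFunction.vonMangoldt_nonneg (Real.sqrt_nonneg _)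
    rw [abs_mul, abs_of_nonneg hw]
    exact (mul_le_mul_of_nonneg_left (Real.abs_sin_le_one _) hw).trans (le_of_eq (mul_one _))
  have hn1' : (1 : ℝ) ≤ n := by exact_mod_cast hn1
  have h1 : a / (π * n) ≤ a / π := by
    apply div_le_div_of_nonneg_left ha.le (by positivity)
    nlinarith [Real.pi_pos]
  have h2 : weilArchDensity (2 * a) * a / (π * n) ≤ weilArchDensity (2 * a) * a / π := by
    apply div_le_div_of_nonneg_left (by positivity) (by positivity)
    nlinarith [Real.pi_pos]
  have e2 : 2 * a / (π * (n : ℝ)) = 2 * (a / (π * n)) := by ring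
  rw [e2] at hY
  generalize (Complex.digamma (1 / 4 + ((freq a n : ℝ) : ℂ) / 2 * I)).im = Y at hY ⊢
  generalize (∑ k ∈ weilPrimeIndex a, (Λ k : ℝ) / Real.sqrt k * Real.sin (freq a n * Real.log k)) = P at hP ⊢
  generalize (∑ k ∈ weilPrimeIndex a, (Λ k : ℝ) / Real.sqrt k) = L at hP hL ⊢
  generalize archExpSumSin a n = T at hT0 hT ⊢
  have hsplit : a * (1 + weilArchDensity (2 * a)) / π = a / π + weilArchDensity (2 * a) * a / π := by ring
  rw [hsplit]
  generalize weilArchDensity (2 * a) * a / (π * n) = U at hT h2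
  generalize weilArchDensity (2 * a) * a / π = U' at h2 ⊢
  generalize a / (π * n) = A at hY h1
  generalize a / π = A' at h1 ⊢
  rw [abs_le] at hY hP ⊢
  constructor
  · linarith [hY.1, hP.1, hT, h2, h1, Real.pi_pos]
  · linarith [hY.2, hP.2, hT0, h1, h2, hT]

end ModeF

/-! ## The order-`J` remainders -/

section Remainder

/-- Termwise identity of the expansion (even): `(mF − iG)/π · i^{2j}/m^{2j+2} = F i^{2j}/(π m^{2j+1}) − G i^{2j+1}/(π m^{2j+2})`. -/
theorem even_expansion_term (F G : ℝ) {i m : ℝ} (hm : m ≠ 0) (j : ℕ) :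
    (m * F - i * G) / π * (i ^ (2 * j) / m ^ (2 * j + 2))
      = F * i ^ (2 * j) / (π * m ^ (2 * j + 1)) - G * i ^ (2 * j + 1) / (π * m ^ (2 * j + 2)) := by
  have hπ : (π : ℝ) ≠ 0 := Real.pi_ne_zero
  rw [show m ^ (2 * j + 2) = m ^ (2 * j + 1) * m from pow_succ m (2 * j + 1),
    show i ^ (2 * j + 1) = i ^ (2 * j) * i from pow_succ i (2 * j)]
  field_simp

/-- Termwise identity of the expansion (odd): `(iF − mG)/π · i^{2j}/m^{2j+2} = F i^{2j+1}/(π m^{2j+2}) − G i^{2j}/(π m^{2j+1})`. -/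
theorem odd_expansion_term (F G : ℝ) {i m : ℝ} (hm : m ≠ 0) (j : ℕ) :
    (i * F - m * G) / π * (i ^ (2 * j) / m ^ (2 * j + 2))
      = F * i ^ (2 * j + 1) / (π * m ^ (2 * j + 2)) - G * i ^ (2 * j) / (π * m ^ (2 * j + 1)) := by
  have hπ : (π : ℝ) ≠ 0 := Real.pi_ne_zero
  rw [show m ^ (2 * j + 2) = m ^ (2 * j + 1) * m from pow_succ m (2 * j + 1),
    show i ^ (2 * j + 1) = i ^ (2 * j) * i from pow_succ i (2 * j)]
  field_simp

/-- The common final estimate: for `0 ≤ i`, `0 < m`, `2i ≤ m`, `|F|, |G| ≤ C` and `|X| ≤ (4/3)·i^{2J}/m^{2J+2}`: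
both `|(mF − iG)/π · X|` and `|(iF − mG)/π · X|` are `≤ 2C i^{2J}/(π m^{2J+1})`. -/
theorem col_remainder_core {i m C F G X : ℝ} (hi : 0 ≤ i) (hm : 0 < m) (him : 2 * i ≤ m)
    (hF : |F| ≤ C) (hG : |G| ≤ C) (J : ℕ) (hX : |X| ≤ 4 / 3 * (i ^ (2 * J) / m ^ (2 * J + 2))) :
    |(m * F - i * G) / π * X| ≤ 2 * C * i ^ (2 * J) / (π * m ^ (2 * J + 1)) ∧
    |(i * F - m * G) / π * X| ≤ 2 * C * i ^ (2 * J) / (π * m ^ (2 * J + 1)) := by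
  have hπ := Real.pi_pos
  have hC : 0 ≤ C := (abs_nonneg F).trans hF
  have hnum1 : |m * F - i * G| ≤ (m + i) * C := by
    calc |m * F - i * G| ≤ |m * F| + |i * G| := abs_sub _ _
      _ = m * |F| + i * |G| := by rw [abs_mul, abs_mul, abs_of_pos hm, abs_of_nonneg hi]
      _ ≤ m * C + i * C := add_le_add (mul_le_mul_of_nonneg_left hF hm.le) (mul_le_mul_of_nonneg_left hG hi)
      _ = (m + i) * C := by ring
  have hnum2 : |i * F - m * G| ≤ (m + i) * C := by
    calc |i * F - m * G| ≤ |i * F| + |m * G| := abs_sub _ _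
      _ = i * |F| + m * |G| := by rw [abs_mul, abs_mul, abs_of_pos hm, abs_of_nonneg hi]
      _ ≤ i * C + m * C := add_le_add (mul_le_mul_of_nonneg_left hF hi) (mul_le_mul_of_nonneg_left hG hm.le)
      _ = (m + i) * C := by ring
  have hX0 : 0 ≤ 4 / 3 * (i ^ (2 * J) / m ^ (2 * J + 2)) := by
    have : 0 ≤ i ^ (2 * J) := by rw [pow_mul]; positivity
    positivity
  -- the target value
  have key : (m + i) * C / π * (4 / 3 * (i ^ (2 * J) / m ^ (2 * J + 2))) ≤ 2 * C * i ^ (2 * J) / (π * m ^ (2 * J + 1)) := by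
    have hiJ : 0 ≤ i ^ (2 * J) := by rw [pow_mul]; positivity
    have hmi : (m + i) * 4 / 3 ≤ 2 * m := by linarith
    have hq : 0 ≤ C * i ^ (2 * J) / (π * m ^ (2 * J + 2)) := by positivity
    have e1 : (m + i) * C / π * (4 / 3 * (i ^ (2 * J) / m ^ (2 * J + 2)))
        = ((m + i) * 4 / 3) * (C * i ^ (2 * J) / (π * m ^ (2 * J + 2))) := by ring
    have e2 : 2 * C * i ^ (2 * J) / (π * m ^ (2 * J + 1)) = (2 * m) * (C * i ^ (2 * J) / (π * m ^ (2 * J + 2))) := by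
      rw [show m ^ (2 * J + 2) = m ^ (2 * J + 1) * m from pow_succ m (2 * J + 1)]
      field_simp
    rw [e1, e2]
    exact mul_le_mul_of_nonneg_right hmi hq
  constructor
  · rw [abs_mul, abs_div, abs_of_pos hπ]
    calc |m * F - i * G| / π * |X| ≤ (m + i) * C / π * (4 / 3 * (i ^ (2 * J) / m ^ (2 * J + 2))) := by
          gcongr
      _ ≤ _ := key
  · rw [abs_mul, abs_div, abs_of_pos hπ]
    calc |i * F - m * G| / π * |X| ≤ (m + i) * C / π * (4 / 3 * (i ^ (2 * J) / m ^ (2 * J + 2))) := by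
          gcongr
      _ ≤ _ := key

/-- **Order-`J` column structure, even sector.**  For `a > 0`, `1 ≤ m`, `2i ≤ m` and every `J`:
`|M⁺(i,m) − (−1)^{i+m}[(4/a)s²c_ic_m + Σ_{j<J}(F_m i^{2j}/(πm^{2j+1}) − F_i i^{2j+1}/(πm^{2j+2}))]| ≤ 2C_F i^{2J}/(π m^{2J+1})`. -/
theorem abs_evenKernel_col_sub_sum_le (ha : 0 < a) {i m : ℕ} (hm : 1 ≤ m) (him : 2 * i ≤ m) (J : ℕ) :
    |(if i = 0 then gramCoeff a 0 m else if m = 0 then gramCoeff a i 0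
        else (gramCoeff a i m + gramCoeff a i (-(m : ℤ))) / 2)
      - (-1 : ℝ) ^ ((i : ℤ) + m) *
        (4 / a * (Real.exp (a / 2) - Real.exp (-(a / 2))) ^ 2 * (1 / (1 + 4 * freq a i ^ 2)) * (1 / (1 + 4 * freq a m ^ 2))
          + ∑ j ∈ Finset.range J,
            (((Complex.digamma (1 / 4 + ((freq a m : ℝ) : ℂ) / 2 * I)).im / 2
                + (∑ k ∈ weilPrimeIndex a, (Λ k : ℝ) / Real.sqrt k * Real.sin (freq a m * Real.log k)) - archExpSumSin a m)
              * (i : ℝ) ^ (2 * j) / (π * (m : ℝ) ^ (2 * j + 1))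
            - ((Complex.digamma (1 / 4 + ((freq a i : ℝ) : ℂ) / 2 * I)).im / 2
                + (∑ k ∈ weilPrimeIndex a, (Λ k : ℝ) / Real.sqrt k * Real.sin (freq a i * Real.log k)) - archExpSumSin a i)
              * (i : ℝ) ^ (2 * j + 1) / (π * (m : ℝ) ^ (2 * j + 2))))|
      ≤ 2 * (π / 4 + (∑ k ∈ weilPrimeIndex a, (Λ k : ℝ) / Real.sqrt k) + a * (1 + weilArchDensity (2 * a)) / π)
          * (i : ℝ) ^ (2 * J) / (π * (m : ℝ) ^ (2 * J + 1)) := by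
  have him' : i < m := by omega
  have hm0 : (0 : ℝ) < m := by exact_mod_cast hm
  have hFm := abs_modeF_le ha m
  have hFi := abs_modeF_le ha i
  rw [evenKernel_col_eq a hm him']
  generalize (Complex.digamma (1 / 4 + ((freq a m : ℝ) : ℂ) / 2 * I)).im / 2
      + (∑ k ∈ weilPrimeIndex a, (Λ k : ℝ) / Real.sqrt k * Real.sin (freq a m * Real.log k)) - archExpSumSin a m = Fm
    at hFm ⊢
  generalize (Complex.digamma (1 / 4 + ((freq a i : ℝ) : ℂ) / 2 * I)).im / 2
      + (∑ k ∈ weilPrimeIndex a, (Λ k : ℝ) / Real.sqrt k * Real.sin (freq a i * Real.log k)) - archExpSumSin a i = Fi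
    at hFi ⊢
  have hsum : ∑ j ∈ Finset.range J, (Fm * (i : ℝ) ^ (2 * j) / (π * (m : ℝ) ^ (2 * j + 1))
        - Fi * (i : ℝ) ^ (2 * j + 1) / (π * (m : ℝ) ^ (2 * j + 2)))
      = ((m : ℝ) * Fm - i * Fi) / π * ∑ j ∈ Finset.range J, (i : ℝ) ^ (2 * j) / (m : ℝ) ^ (2 * j + 2) := by
    rw [Finset.mul_sum]
    exact Finset.sum_congr rfl fun j _ ↦ (even_expansion_term Fm Fi hm0.ne' j).symm
  have e : (-1 : ℝ) ^ ((i : ℤ) + m) *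
        (4 / a * (Real.exp (a / 2) - Real.exp (-(a / 2))) ^ 2 * (1 / (1 + 4 * freq a i ^ 2)) * (1 / (1 + 4 * freq a m ^ 2))
          + ((m : ℝ) * Fm - i * Fi) / (π * ((m : ℝ) ^ 2 - i ^ 2)))
      - (-1 : ℝ) ^ ((i : ℤ) + m) *
        (4 / a * (Real.exp (a / 2) - Real.exp (-(a / 2))) ^ 2 * (1 / (1 + 4 * freq a i ^ 2)) * (1 / (1 + 4 * freq a m ^ 2))
          + ∑ j ∈ Finset.range J, (Fm * (i : ℝ) ^ (2 * j) / (π * (m : ℝ) ^ (2 * j + 1))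
            - Fi * (i : ℝ) ^ (2 * j + 1) / (π * (m : ℝ) ^ (2 * j + 2))))
      = (-1 : ℝ) ^ ((i : ℤ) + m) * (((m : ℝ) * Fm - i * Fi) / π *
          (1 / ((m : ℝ) ^ 2 - i ^ 2) - ∑ j ∈ Finset.range J, (i : ℝ) ^ (2 * j) / (m : ℝ) ^ (2 * j + 2))) := by
    rw [hsum, ← div_div]
    ring
  rw [e, abs_mul, abs_neg_one_zpow_natCast_add', one_mul]
  have hX := abs_inv_sq_sub_sq_sub_sum_le (m : ℝ) (i : ℝ) hm0
    (by rw [abs_of_nonneg (Nat.cast_nonneg i)]; exact_mod_cast him) J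
  exact (col_remainder_core (Nat.cast_nonneg i) hm0 (by exact_mod_cast him) hFm hFi J hX).1

/-- **Order-`J` column structure, odd sector.**  For `a > 0`, `1 ≤ i`, `2i ≤ m` (modes) and every `J`:
`|M⁻(i,m) − (−1)^{i+m}[−(16/a)s²d_id_m + Σ_{j<J}(F_m i^{2j+1}/(πm^{2j+2}) − F_i i^{2j}/(πm^{2j+1}))]| ≤ 2C_F i^{2J}/(π m^{2J+1})`. -/
theorem abs_oddKernel_col_sub_sum_le (ha : 0 < a) {i m : ℕ} (hi : 1 ≤ i) (him : 2 * i ≤ m) (J : ℕ) :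
    |(gramCoeff a i m - gramCoeff a i (-(m : ℤ))) / 2
      - (-1 : ℝ) ^ ((i : ℤ) + m) *
        (-(16 / a * (Real.exp (a / 2) - Real.exp (-(a / 2))) ^ 2) * (freq a i / (1 + 4 * freq a i ^ 2))
            * (freq a m / (1 + 4 * freq a m ^ 2))
          + ∑ j ∈ Finset.range J,
            (((Complex.digamma (1 / 4 + ((freq a m : ℝ) : ℂ) / 2 * I)).im / 2
                + (∑ k ∈ weilPrimeIndex a, (Λ k : ℝ) / Real.sqrt k * Real.sin (freq a m * Real.log k)) - archExpSumSin a m)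
              * (i : ℝ) ^ (2 * j + 1) / (π * (m : ℝ) ^ (2 * j + 2))
            - ((Complex.digamma (1 / 4 + ((freq a i : ℝ) : ℂ) / 2 * I)).im / 2
                + (∑ k ∈ weilPrimeIndex a, (Λ k : ℝ) / Real.sqrt k * Real.sin (freq a i * Real.log k)) - archExpSumSin a i)
              * (i : ℝ) ^ (2 * j) / (π * (m : ℝ) ^ (2 * j + 1))))|
      ≤ 2 * (π / 4 + (∑ k ∈ weilPrimeIndex a, (Λ k : ℝ) / Real.sqrt k) + a * (1 + weilArchDensity (2 * a)) / π)
          * (i : ℝ) ^ (2 * J) / (π * (m : ℝ) ^ (2 * J + 1)) := by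
  have him' : i < m := by omega
  have hm : 1 ≤ m := by omega
  have hm0 : (0 : ℝ) < m := by exact_mod_cast hm
  have hFm := abs_modeF_le ha m
  have hFi := abs_modeF_le ha i
  rw [oddKernel_col_eq a hi him']
  generalize (Complex.digamma (1 / 4 + ((freq a m : ℝ) : ℂ) / 2 * I)).im / 2
      + (∑ k ∈ weilPrimeIndex a, (Λ k : ℝ) / Real.sqrt k * Real.sin (freq a m * Real.log k)) - archExpSumSin a m = Fm
    at hFm ⊢
  generalize (Complex.digamma (1 / 4 + ((freq a i : ℝ) : ℂ) / 2 * I)).im / 2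
      + (∑ k ∈ weilPrimeIndex a, (Λ k : ℝ) / Real.sqrt k * Real.sin (freq a i * Real.log k)) - archExpSumSin a i = Fi
    at hFi ⊢
  have hsum : ∑ j ∈ Finset.range J, (Fm * (i : ℝ) ^ (2 * j + 1) / (π * (m : ℝ) ^ (2 * j + 2))
        - Fi * (i : ℝ) ^ (2 * j) / (π * (m : ℝ) ^ (2 * j + 1)))
      = ((i : ℝ) * Fm - m * Fi) / π * ∑ j ∈ Finset.range J, (i : ℝ) ^ (2 * j) / (m : ℝ) ^ (2 * j + 2) := by
    rw [Finset.mul_sum]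
    exact Finset.sum_congr rfl fun j _ ↦ (odd_expansion_term Fm Fi hm0.ne' j).symm
  have e : (-1 : ℝ) ^ ((i : ℤ) + m) *
        (-(16 / a * (Real.exp (a / 2) - Real.exp (-(a / 2))) ^ 2) * (freq a i / (1 + 4 * freq a i ^ 2))
            * (freq a m / (1 + 4 * freq a m ^ 2))
          + ((i : ℝ) * Fm - m * Fi) / (π * ((m : ℝ) ^ 2 - i ^ 2)))
      - (-1 : ℝ) ^ ((i : ℤ) + m) *
        (-(16 / a * (Real.exp (a / 2) - Real.exp (-(a / 2))) ^ 2) * (freq a i / (1 + 4 * freq a i ^ 2))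
            * (freq a m / (1 + 4 * freq a m ^ 2))
          + ∑ j ∈ Finset.range J, (Fm * (i : ℝ) ^ (2 * j + 1) / (π * (m : ℝ) ^ (2 * j + 2))
            - Fi * (i : ℝ) ^ (2 * j) / (π * (m : ℝ) ^ (2 * j + 1))))
      = (-1 : ℝ) ^ ((i : ℤ) + m) * (((i : ℝ) * Fm - m * Fi) / π *
          (1 / ((m : ℝ) ^ 2 - i ^ 2) - ∑ j ∈ Finset.range J, (i : ℝ) ^ (2 * j) / (m : ℝ) ^ (2 * j + 2))) := by
    rw [hsum, ← div_div]
    ring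
  rw [e, abs_mul, abs_neg_one_zpow_natCast_add', one_mul]
  have hX := abs_inv_sq_sub_sq_sub_sum_le (m : ℝ) (i : ℝ) hm0
    (by rw [abs_of_nonneg (Nat.cast_nonneg i)]; exact_mod_cast him) J
  exact (col_remainder_core (Nat.cast_nonneg i) hm0 (by exact_mod_cast him) hFm hFi J hX).2

end Remainder

end Summit.RiemannHypothesis.RiemannHypothesis.Theorems.WeilFormatC

end
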